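import Summits.CriticalPhenomena.PercolationContinuityZ3.Theses.PercDivergentSlabLadder
import Summits.CriticalPhenomena.PercolationContinuityZ3.Theorems.PercNearOneGluingNoHeavyLowerTailCSHTheoremOne
import Literature.Probability.Percolation.SubgraphMonotonicity
import Literature.Probability.Percolation.ConnectivityProofs
import HarnessLib

/-!
# `PercDivergentSlabLadder.FreeRung` (stmt-CriticalPhenomena-6703) — SETTLED after continuity

Item `stmt-CriticalPhenomena-6703` of route `CriticalPhenomena/PercDivergentSlabLadder` (support): the free rung: a nondecreasing unbounded `f` with `θ_{V_f} = 0` at `p_c` at every vertex of the divergent slab `V_f = {|x₀| ≤ f(ρ)}`.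

With `θ(p_c(ℤ³)) = 0` (p205010), `θ` of every INDUCED subgraph of `ℤ³` vanishes at `p_c` at every vertex: `θ_{G[S]}(x, p_c) ≤ θ_{ℤ³}(x, p_c)` (`theta_induce_le_holds`) `= θ_{ℤ³}(0, p_c)` (`theta_zdGraph_eq_theta_zero`) `= 0`.  Witness `f = id`.

builds on p205010 (kernel theorem, internal audit signed; external expert review pending) — USED (`CSH.percolationContinuityZ3_holds`).  RSW3 lane, lead gen 28 (prover-prim-rsw3-lead-g28-0):
'after continuity — the ledger harvest'.
References: G. Kozma, N. Nitzan (2024), Thm. 6 / Conj. 3 [KozmaNitzan2024]; G. Grimmett, *Percolation* (1999), §8 [GrimmettPercolation1999].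
-/

noncomputable section

namespace Summit.CriticalPhenomena.PercolationContinuityZ3.Theorems

namespace PercDivergentSlabLadderFreeRung

open MeasureTheory Literature.Probability.Percolation Literature.Probability.LatticeModels

/-- **`PercDivergentSlabLadder.FreeRung` (stmt-CriticalPhenomena-6703), settled.**  witness `f = id`; `θ_{G[V_f]}(x,p_c) ≤ θ_{ℤ³}(p_c) = 0`.
[cite: KozmaNitzan2024, Thm. 6 with Conj. 3 (p. 15)] -/
theorem freeRung_proof : Summit.CriticalPhenomena.PercolationContinuityZ3.Theses.PercDivergentSlabLadder.FreeRung := by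
  unfold Summit.CriticalPhenomena.PercolationContinuityZ3.Theses.PercDivergentSlabLadder.FreeRung
  refine ⟨id, monotone_id, fun K => ⟨K, le_rfl⟩, fun x => ?_⟩
  have h0 : theta (zdGraph 3) (0 : Site 3) (criticalProbI 3) = 0 := CSH.percolationContinuityZ3_holds
  have h1 := theta_induce_le_holds (zdGraph 3) _ (x : Site 3) x.2 (criticalProbI 3)
  rw [theta_zdGraph_eq_theta_zero, h0] at h1
  exact le_antisymm h1 (by unfold theta; exact measureReal_nonneg)

end PercDivergentSlabLadderFreeRung

end Summit.CriticalPhenomena.PercolationContinuityZ3.Theorems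

end
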